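import Mathlib
import Summits.ValiantsHypothesis.ValiantsHypothesis.Theses.FeketeSOS
import Summits.ValiantsHypothesis.ValiantsHypothesis.Theorems.FeketeSOSCharPSparseSOSStubFeketeCuspInf
import Summits.ValiantsHypothesis.ValiantsHypothesis.Theorems.FeketeSOSCharPSparseSOSStubFeketeCuspZero
import Summits.ValiantsHypothesis.ValiantsHypothesis.Theorems.FeketeSOSCharPSparseSOSStubDictionaryAtInfinity
import Summits.ValiantsHypothesis.ValiantsHypothesis.Theorems.FeketeSOSCharPSparseSOSStubDictionaryAtZero
import Summits.ValiantsHypothesis.ValiantsHypothesis.Theorems.FeketeSOSCharPSparseSOSStubTwoCuspHajos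
import Summits.ValiantsHypothesis.ValiantsHypothesis.Theorems.FeketeSOSCharPSparseSOSStubWeylSymmetry

/-!
# Crux `FeketeSOS.CharPSparseSOS` (stmt-ValiantsHypothesis-14989) — line `Sketch`, lead skeleton

Spine: the two-cusp composition of card `steinberg-two-cusp` (crux-ideate r1, ideator 2; composition
adapted from `Cruxes/CharPSparseSOS/SketchIdeator2.lean`), with the lower-cusp interpolation dictionary of
card `interpolation-dual-redei` (ideator 1) as toolkit.

Read a cyclic representation `X^p − 1 ∣ Σ_{i<s} c_i g_i² − F̄_p` over a field `K` of characteristic `p` as an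
identity of coefficient functions `h : 𝔽_p → K`.  Two depths:
* `δ_∞(P) ≥ D` iff `(X − 1)^D ∣ P` (the route's Euler/Hajós lever; = vanishing of the power moments
  `μ_a = Σ_n P_n n^a`, `a < D`);
* `δ_0(P) ≥ D` iff `P_0 = 0` and the TOP moments `μ_{p−1−d}`, `1 ≤ d < D`, vanish (= `U^D` divides the
  Lagrange interpolation polynomial `Σ_n P_n (1 − (U − n)^{p−1})` of the coefficient function).
The target has BOTH depths exactly `M = (p−1)/2` (stubs `stub_feketeCuspInf`, `stub_feketeCuspZero`); the
load-bearing stub `stub_twoCuspInequality` (UFA², here in the POWER-SAVING form, weaker than the card's linear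
form and still sufficient) bounds `min(δ_∞, δ_0)` of any non-zero cyclic weighted sum of `s` squares by
`C₀ (s+1)^{A₀} (Σ #supp g_i)^θ` with `θ < 2` (the trivial bound is `θ = 2`: `min ≤ #supp ≤ Σ t_i²`).
`CharPSparseSOS_of` is the kernel-checked composition.  Stubs 3–6 are the dictionary / two-cusp Hajós /
Weyl-symmetry tools of the line (used by the proof of the load-bearing stub, not by the composition).

All statements are over Mathlib vocabulary only (no new definitions): `F̄_p` is the crux's inlined sum,
moments are `Σ_{n<p} P.coeff n * n^a` (`0^0 = 1`), the fold is `%ₘ (X^p − 1)`.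
-/

set_option linter.dupNamespace false

namespace Summit.ValiantsHypothesis.ValiantsHypothesis.Theorems.CharPSparseSOSTwoCusp

open Polynomial Finset
open scoped BigOperators

/-! ## Registered stubs -/

/-! Stubs 1–6 are LANDED (imported above, same namespace):
`stub_feketeCuspInf` (p96978), `stub_feketeCuspZero` (p97528), `stub_dictionaryAtInfinity` (p97397),
`stub_dictionaryAtZero` (p97396), `stub_twoCuspHajos` (p97424), `stub_weylSymmetry` (p99583).
The baseline `twoCuspInequality_theta_two` (θ = 2, trivial exponent) of Stub 7 is p100193
(Theorems/FeketeSOSCharPSparseSOSTwoCuspTrivial.lean). -/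

/-- **Stub 7 (UFA², the two-cusp fewnomial inequality with power saving — LOAD-BEARING, open).** There are
constants `C₀ > 0`, `0 ≤ θ < 2`, `A₀` such that every non-zero fold `P = (Σ_{i<s} c_i g_i²) mod (X^p − 1)`
(`deg g_i < p`) that is deep at both cusps — `(X−1)^D ∣ P`, `P_0 = 0`, `Σ_n P_n n^{p−1−d} = 0` for
`1 ≤ d < D` — has `D ≤ C₀ (s+1)^{A₀} (Σ_i #supp g_i)^θ`.  The trivial exponent is `θ = 2`
(`D ≤ #supp P ≤ Σ_i #supp g_i (#supp g_i + 1)/2` by Stub 5 applied to `P`); the card conjectures `θ = 1`,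
`C₀ = 1 + o(1)`; ANY `θ < 2` closes the crux (`CharPSparseSOS_of`).  Note (cdisprove cycle 1): `θ ≥ 1` is forced —
the target itself with the trivial two squares `(½(F̄_p ± 1))²` has `D = (p−1)/2`, `T ≤ 2p` — so the admissible range
is exactly `1 ≤ θ < 2`.  Sub-goals registered on the item: `twoCuspInequality_theta_two` (θ = 2, landed p100193),
`twoCuspInequality_s_le_two` (s ≤ 2, linear, p101692), `twoCuspUncertainty` (p103252), `twoCuspJointSupport`
(2D ≤ #supp P, both cusps, p108086), `twoCuspInequality_nonCancelling` (fat branch, general s, p108029),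
`squareVsSparse_oneCusp` (operator 2B·d/dX − B′: c₀C² ≡ k-sparse B ⇒ D ≤ (k+2)t + k or socle window, p109017),
`twoCuspInequality_twoMonomialSquares` (first cancelling case of s = 3, D ≤ 2t+1, p109368),
`twoCuspInequality_oneFatSquare` (one fat square + small squares ⇒ linear, both cusps, p110206),
`twoCuspInequality_s_three` (first open case; needs a second-cusp engine for products — see
Cruxes/CharPSparseSOS/NOTES.md §C, §G, §J), and the barrier records `no_qrPerfectSumSet_of_charPSparseSOS`,
`rQ_far_from_QR_of_charPSparseSOS` (the crux implies a power-saving strengthening of Shkredov 2014, NOTES.md §I),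
`twoCusp_fullDepth_rigidity` (lead c2, p115769: at `D = (p−1)/2` the hypotheses below force `P ∈ Kˣ·F̄_p` — the
composition is lossless) and `signedQuarticFar_of_twoCuspInequality_s_three` (lead c2: already the case `s = 3`
implies a `p^δ`-robust index-4 Sárközy/Shkredov theorem — the quartic sign on QR is two-cusp deep `(p−1)/4` and
reachable by one weighted square plus a two-square error patch — NOTES.md §M; line verdict `Lines/Sketch.dead.md`). -/
theorem stub_twoCuspInequality :
    ∃ (C₀ θ : ℝ) (A₀ : ℕ), 0 < C₀ ∧ 0 ≤ θ ∧ θ < 2 ∧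
      ∀ (K : Type) [Field K] (p : ℕ) [Fact p.Prime] [CharP K p]
        (s : ℕ) (c : Fin s → K) (g : Fin s → K[X]) (P : K[X]) (D : ℕ),
        (∀ i, (g i).natDegree < p) →
        P = (∑ i, C (c i) * g i ^ 2) %ₘ (X ^ p - 1) →
        P ≠ 0 →
        (X - C (1 : K)) ^ D ∣ P →
        (1 ≤ D → P.coeff 0 = 0) →
        (∀ d : ℕ, 1 ≤ d → d < D → ∑ n ∈ Finset.range p, P.coeff n * (n : K) ^ (p - 1 - d) = 0) →
        (D : ℝ) ≤ C₀ * ((s : ℝ) + 1) ^ A₀ * ((∑ i, (g i).support.card : ℕ) : ℝ) ^ θ := by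
  sorry

/-! ## Composition -/

/-- `F̄_p` has degree `< p`. -/
theorem degree_feketeSum_lt (K : Type) [Field K] (p : ℕ) [Fact p.Prime] :
    (∑ m ∈ Finset.range p, C ((legendreSym p m : ℤ) : K) * X ^ m).degree < (p : WithBot ℕ) := by
  refine lt_of_le_of_lt (degree_sum_le _ _) ((Finset.sup_lt_iff (WithBot.bot_lt_coe p)).2 ?_)
  intro m hm
  refine lt_of_le_of_lt (degree_C_mul_X_pow_le m _) ?_
  exact WithBot.coe_lt_coe.2 (Finset.mem_range.1 hm)

/-- **Composition.** Stubs 1, 2 and 7 give the crux: a cyclic representation folds to `F̄_p` itself, which is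
deep `(p−1)/2` at both cusps, so `(p−1)/2 ≤ C₀ (s+1)^{A₀} T^θ ≤ C₀ 2^{A₀} p^{δA₀} T^θ`; with
`T < p^{1/2+δ}` and `δ = (1 − θ/2) / (2 (A₀ + 2))` this bounds `p^{(1−θ/2)/2}` by a constant. -/
theorem CharPSparseSOS_of :
    Summit.ValiantsHypothesis.ValiantsHypothesis.Theses.FeketeSOS.CharPSparseSOS := by
  unfold Summit.ValiantsHypothesis.ValiantsHypothesis.Theses.FeketeSOS.CharPSparseSOS
  obtain ⟨C₀, θ, A₀, hC₀, hθ0, hθ2, hU⟩ := stub_twoCuspInequality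
  -- exponent bookkeeping
  set η : ℝ := 1 - θ / 2 with hη
  have hηpos : 0 < η := by rw [hη]; linarith
  set δ : ℝ := η / (2 * ((A₀ : ℝ) + 2)) with hδ
  have hA2 : (0 : ℝ) < (A₀ : ℝ) + 2 := by positivity
  have hδpos : 0 < δ := by rw [hδ]; positivity
  -- the key exponent identity: δ A₀ + θ (1/2 + δ) + (η - δ (A₀ + θ)) = 1
  have hθη : θ = 2 - 2 * η := by rw [hη]; ring
  have hrest_pos : 0 < η - δ * ((A₀ : ℝ) + θ) := by
    have hθle : θ ≤ 2 := hθ2.le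
    have h1 : δ * ((A₀ : ℝ) + θ) ≤ δ * ((A₀ : ℝ) + 2) :=
      mul_le_mul_of_nonneg_left (by linarith) hδpos.le
    have h2 : δ * ((A₀ : ℝ) + 2) = η / 2 := by
      rw [hδ]; field_simp
    linarith
  set ρ : ℝ := η - δ * ((A₀ : ℝ) + θ) with hρ
  have hexp : δ * (A₀ : ℝ) + θ * (1 / 2 + δ) + ρ = 1 := by
    rw [hρ, hθη]; ring
  -- threshold
  set L : ℝ := 4 * (C₀ * 2 ^ A₀) with hL
  have hL0 : 0 < L := by rw [hL]; positivity
  obtain ⟨N, hN⟩ : ∃ N : ℕ, L ^ (1 / ρ) ≤ (N : ℝ) := ⟨_, Nat.le_ceil _⟩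
  refine ⟨δ, hδpos, max N 5, ?_⟩
  intro p _ hp K _ _ s c g hs hdeg hdvd
  have hprime : p.Prime := Fact.out
  have hp5 : 5 ≤ p := le_trans (le_max_right _ _) hp
  have hpN : N ≤ p := le_trans (le_max_left _ _) hp
  have hp2 : p ≠ 2 := by omega
  have hp1 : (1 : ℝ) ≤ (p : ℝ) := by exact_mod_cast hprime.one_lt.le
  have hp0 : (0 : ℝ) < (p : ℝ) := by linarith
  -- the fold of the representation IS `F̄_p`
  set F : K[X] := ∑ m ∈ Finset.range p, C ((legendreSym p m : ℤ) : K) * X ^ m with hF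
  have hmonic : ((X : K[X]) ^ p - 1).Monic :=
    monic_X_pow_sub (by rw [degree_one]; exact_mod_cast hprime.pos)
  have hdegq : ((X : K[X]) ^ p - 1).degree = p := by
    rw [← C_1, degree_X_pow_sub_C hprime.pos]
  have hfold : (∑ i, C (c i) * g i ^ 2) %ₘ (X ^ p - 1) = F := by
    rw [modByMonic_eq_of_dvd_sub hmonic hdvd]
    exact (modByMonic_eq_self_iff hmonic).2 (by rw [hdegq]; exact degree_feketeSum_lt K p)
  obtain ⟨hInf, hInfNot⟩ := stub_feketeCuspInf K p hp2
  obtain ⟨hZ0, hZmom, -⟩ := stub_feketeCuspZero K p hp2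
  have hne : F ≠ 0 := by
    intro h0; exact hInfNot (by rw [← hF, h0]; exact dvd_zero _)
  have hmain := hU K p s c g F ((p - 1) / 2) hdeg hfold.symm hne hInf (fun _ => hZ0) hZmom
  -- cast to ℝ
  set T : ℕ := ∑ i, (g i).support.card with hT
  have hcastT : (∑ i, ((g i).support.card : ℝ)) = (T : ℝ) := by rw [hT]; push_cast; rfl
  rw [hcastT]
  have hT0 : (0 : ℝ) ≤ (T : ℝ) := Nat.cast_nonneg T
  -- (s+1)^A₀ ≤ 2^A₀ p^(δ A₀)
  have hpδ1 : (1 : ℝ) ≤ (p : ℝ) ^ δ := Real.one_le_rpow hp1 hδpos.le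
  have hs1 : (s : ℝ) + 1 ≤ 2 * (p : ℝ) ^ δ := by linarith
  have hsA : ((s : ℝ) + 1) ^ A₀ ≤ (2 : ℝ) ^ A₀ * (p : ℝ) ^ (δ * A₀) := by
    have h := pow_le_pow_left₀ (by positivity) hs1 A₀
    have e : (2 * (p : ℝ) ^ δ) ^ A₀ = (2 : ℝ) ^ A₀ * (p : ℝ) ^ (δ * A₀) := by
      rw [mul_pow, ← Real.rpow_natCast ((p : ℝ) ^ δ) A₀, ← Real.rpow_mul hp0.le]
    rw [e] at h; exact h
  set K₀ : ℝ := C₀ * 2 ^ A₀ with hK₀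
  have hK₀pos : 0 < K₀ := by rw [hK₀]; positivity
  have hTθ0 : (0 : ℝ) ≤ (T : ℝ) ^ θ := Real.rpow_nonneg hT0 θ
  -- threshold: L ≤ p^ρ
  have hLp : L ≤ (p : ℝ) ^ ρ := by
    have hbase : L ^ (1 / ρ) ≤ (p : ℝ) := hN.trans (by exact_mod_cast hpN)
    have hb0 : (0 : ℝ) ≤ L ^ (1 / ρ) := Real.rpow_nonneg hL0.le _
    have hmono : (L ^ (1 / ρ)) ^ ρ ≤ (p : ℝ) ^ ρ := Real.rpow_le_rpow hb0 hbase hrest_pos.le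
    have hid : (L ^ (1 / ρ)) ^ ρ = L := by
      rw [← Real.rpow_mul hL0.le]
      have : (1 / ρ) * ρ = 1 := by field_simp
      rw [this, Real.rpow_one]
    rw [hid] at hmono; exact hmono
  by_contra hlt
  push Not at hlt
  -- T < p^(1/2+δ)  ⇒  T^θ ≤ p^(θ (1/2+δ))
  have hTθ : (T : ℝ) ^ θ ≤ (p : ℝ) ^ (θ * (1 / 2 + δ)) := by
    have h1 : (T : ℝ) ^ θ ≤ ((p : ℝ) ^ (1 / 2 + δ)) ^ θ := Real.rpow_le_rpow hT0 hlt.le hθ0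
    rwa [← Real.rpow_mul hp0.le, mul_comm] at h1
  have hpos : 0 < K₀ * (p : ℝ) ^ (δ * A₀) := mul_pos hK₀pos (Real.rpow_pos_of_pos hp0 _)
  have h2 : K₀ * (p : ℝ) ^ (δ * A₀) * (T : ℝ) ^ θ ≤
      K₀ * (p : ℝ) ^ (δ * A₀) * (p : ℝ) ^ (θ * (1 / 2 + δ)) :=
    mul_le_mul_of_nonneg_left hTθ hpos.le
  have e1 : K₀ * (p : ℝ) ^ (δ * A₀) * (p : ℝ) ^ (θ * (1 / 2 + δ)) =
      K₀ * (p : ℝ) ^ (δ * A₀ + θ * (1 / 2 + δ)) := by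
    rw [mul_assoc, ← Real.rpow_add hp0]
  have e2 : (p : ℝ) = (p : ℝ) ^ (δ * A₀ + θ * (1 / 2 + δ)) * (p : ℝ) ^ ρ := by
    rw [← Real.rpow_add hp0, hexp, Real.rpow_one]
  have hq0 : 0 < (p : ℝ) ^ (δ * A₀ + θ * (1 / 2 + δ)) := Real.rpow_pos_of_pos hp0 _
  -- strictness from the slack p/4 < (p-1)/2 (p ≥ 5):  p/4 < K₀ p^(a) T^θ ≤ K₀ p^(a) p^(θ(1/2+δ)),
  -- and p = p^(a + θ(1/2+δ)) p^ρ, so p^ρ < 4 K₀ = L ≤ p^ρ.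
  have hMR' : (p : ℝ) / 4 < (((p - 1) / 2 : ℕ) : ℝ) := by
    have h1 : p - 2 ≤ 2 * ((p - 1) / 2) := by omega
    have h3 : ((p - 2 : ℕ) : ℝ) ≤ ((2 * ((p - 1) / 2) : ℕ) : ℝ) := by exact_mod_cast h1
    have h4 : ((p - 2 : ℕ) : ℝ) = (p : ℝ) - 2 := by
      rw [Nat.cast_sub (by omega : 2 ≤ p)]; norm_num
    rw [h4] at h3; push_cast at h3
    have : (5 : ℝ) ≤ (p : ℝ) := by exact_mod_cast hp5
    linarith
  have hkey' : (p : ℝ) / 4 < K₀ * (p : ℝ) ^ (δ * A₀) * (T : ℝ) ^ θ := by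
    have h1 : C₀ * ((s : ℝ) + 1) ^ A₀ * (T : ℝ) ^ θ ≤
        C₀ * ((2 : ℝ) ^ A₀ * (p : ℝ) ^ (δ * A₀)) * (T : ℝ) ^ θ := by
      apply mul_le_mul_of_nonneg_right _ hTθ0
      exact mul_le_mul_of_nonneg_left hsA hC₀.le
    have e : C₀ * ((2 : ℝ) ^ A₀ * (p : ℝ) ^ (δ * A₀)) * (T : ℝ) ^ θ =
        K₀ * (p : ℝ) ^ (δ * A₀) * (T : ℝ) ^ θ := by
      rw [hK₀]; ring
    linarith [hMR', hmain, h1, e.le, e.ge]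
  have h3' : (p : ℝ) ^ (δ * A₀ + θ * (1 / 2 + δ)) * (p : ℝ) ^ ρ / 4 <
      K₀ * (p : ℝ) ^ (δ * A₀ + θ * (1 / 2 + δ)) := by
    have := lt_of_lt_of_le hkey' h2
    rw [e1] at this; rw [← e2]; exact this
  have h4' : (p : ℝ) ^ ρ / 4 < K₀ := by
    have h5 : (p : ℝ) ^ (δ * A₀ + θ * (1 / 2 + δ)) * ((p : ℝ) ^ ρ / 4) <
        (p : ℝ) ^ (δ * A₀ + θ * (1 / 2 + δ)) * K₀ := by
      have : (p : ℝ) ^ (δ * A₀ + θ * (1 / 2 + δ)) * ((p : ℝ) ^ ρ / 4) =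
          (p : ℝ) ^ (δ * A₀ + θ * (1 / 2 + δ)) * (p : ℝ) ^ ρ / 4 := by ring
      rw [this, mul_comm _ K₀]; exact h3'
    exact lt_of_mul_lt_mul_left h5 hq0.le
  have h6' : (p : ℝ) ^ ρ < L := by rw [hL]; linarith
  linarith [hLp]

end Summit.ValiantsHypothesis.ValiantsHypothesis.Theorems.CharPSparseSOSTwoCusp
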